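import Summits.QuantumFields.YangMills.Theorems.UnitScaleTiltProp7CornerCombCellKnit
import HarnessLib

/-!
# Route `UnitScaleTilt`, crux K1 «MinimiserStabilityRegPr» (stmt-QuantumFields-19200), route-R E′ (A′)-on-Σ, P-A2 (β), row «(n3)-comb» `hMcomb` —
# lane (II) file F-6d-3′ «Σ OVER CORNERS, WINDOW-RESTRICTED»: ✓F-6d-3 `sum_cell_normSq_covGrad_gauge_le` with its two tower binders `hV`, `hΛs` restricted to the levels `i ≤ k′`
# that the member can supply (unitarity of the averaged backgrounds and the gauge recursion are only available inside the window) — derived from ✓F-6d-3 by a splice of the tower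

Cell `ym3-torus` (HUMAN RULING D-0037: YM₃ on the torus is ladder rung R3 — not d = 4, not a mass gap, not Clay), D-0154 (3c) R3 twin-width seat `ym-routeR-w6` (gen 9);
★routeR-w1 g9 PENS ROUND 4 «F-6d → routeR-w6»; the restriction is w5-19200 g8's consumer flag (2026-08-29 11:25:13Z, the F-8b-5b pen: `V i := Ūⁱ` is `U1`-valued only for
`i ≤ k`, lit ✓`B8Prop7AdmittedFamily.avgIter_mem_unitaryUnits : ∀ j ≤ k`), and the splice is w3-19200 g14's (3d′ SIGNATURE 11:35:38Z, typed for the per-corner row; done here ONCE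
at the cell level so the per-corner file needs no twin).  `--supports stmt-QuantumFields-19200 --as helper`; THEOREMS ONLY (0 `def`, 0 `sorry`); count-neutral.  «(O2) groundwork —
route-internal row (n3)-comb, NOT N06, NOT a print row; OPEN».  Nothing of `hMcomb`, `hMcomb₂`, (β), `hPA2`, `hcoS`, E′, EX, the stub, the crux, d = 4 or the gap is claimed.

THE POINT.  ✓F-6d-3 asks `hV : ∀ i x μ, V i x μ ∈ U1` and `hΛs : ∀ i y, Λ (i+1) y = F̂^{V i}(G i)(L•y) + Λ i (L•y)` at EVERY level `i`, but reads them only for `i ≤ k′` (the top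
transport `V̄_{k′}`, the chains `j < k′`, the blocks `i ≤ k′`).  The member's tower `V i := avgIter L U₀♯ i` is `U1`-valued only inside the loop window, so the consumer (F-8b-5b) can
supply exactly the restricted forms.  SPLICE: `V′ i := V (min i k′)`-style (`V i` for `i ≤ k′`, the top background `V k′` repeated above — `U1` everywhere from the restricted `hV`),
`Λ′ :=` the full recursion over `V′` started at `Λ 0` (`hΛs` for every `i` by `rfl`); then `Λ′ i = Λ i` for `i ≤ k′+1` by induction on the restricted `hΛs`, every other hypothesis
of ✓F-6d-3 transfers through `V′ i = V i` (`i ≤ k′`), and ✓F-6d-3 at `(V′, Λ′)` IS the restricted statement after rewriting `V′ ↦ V` inside the two level sums (`Finset.sum_congr` on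
`range k′`, `range (k′+1)`) and `Λ′ (k′+1) ↦ Λ (k′+1)`, `V′ k′ ↦ V k′` outside.

WHAT IS PROVED (ns `…Theorems.Prop7CornerCombCellKnitOfLe`): ★★★ `sum_cell_normSq_covGrad_gauge_le_of_le` — ✓F-6d-3's statement TOKEN FOR TOKEN except
`(hV : ∀ i, i ≤ k' → ∀ x μ, V i x μ ∈ U1 …)` and `(hΛs : ∀ i, i ≤ k' → ∀ y, Λ (i + 1) y = …)`.
HONEST SCOPE.  A re-packaging of ✓F-6d-3 by a 40-line splice; no estimate.  Rung R3, not Clay; YM gap NOT proved.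

References: T. Bałaban, CMP **98** (1985) 17–51 [Balaban1985Averaging] ((2) p.17, (42)–(47) pp.23–25, (112) p.34, (125)–(126) p.36); CMP **95** (1984) 17–40 [Balaban1984PropagatorsI]
((1.18)–(1.20) pp.19–20); CMP **109** (1987) 249–301 [Balaban1987RG1] ((0.1) p.251).
-/

set_option autoImplicit false

noncomputable section

open scoped BigOperators Matrix.Norms.L2Operator

namespace Summit.QuantumFields.YangMills.Theorems.Prop7CornerCombCellKnitOfLe

open Finset
open Literature.MathematicalPhysics.QuantumFieldTheory.Balaban1983to89
open B7Prop1Explicit (Site Letter e hol seg treeWord boxVec plaqWord U1 Wcx bavg)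
open B7Eq78Linearization (conjR)
open B7Prop3GeneralLinear (FhatCov)
open Summit.QuantumFields.YangMills.Theorems.Prop7CornerCombCellKnit (sum_cell_normSq_covGrad_gauge_le)

variable {d N : ℕ} [NeZero N]

/-- ★★★ **Σ OVER CORNERS, WINDOW-RESTRICTED** — ✓F-6d-3 `sum_cell_normSq_covGrad_gauge_le` with `hV`∕`hΛs` asked only for the levels `i ≤ k′` (everything else, conclusion included,
token for token).  Proof: the splice `V′ i := V i (i ≤ k′), V k′ (i > k′)`, `Λ′ :=` the full recursion over `V′`, `Λ′ i = Λ i` for `i ≤ k′+1`; ✓F-6d-3 at `(V′, Λ′)`; rewrite back.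
[cite: Balaban1985Averaging, (2) p.17, (42)-(47) pp.23-25, (112) p.34, (125)-(126) p.36; Balaban1984PropagatorsI, (1.18)-(1.20) pp.19-20; Balaban1987RG1, (0.1) p.251] -/
theorem sum_cell_normSq_covGrad_gauge_le_of_le (L : ℕ) (hL : 2 ≤ L) (n A : ℕ) (hn : L * L + L ≤ n + 1) (hnA : n + 1 ≤ A * (L * L))
    (k' N' : ℕ) [NeZero N'] (Nc : ℕ → ℕ) (hNc : ∀ i, i ≤ k' + 1 → Nc i = N' * L ^ (k' + 1 - i))
    (V : ℕ → Site d → Fin d → (Matrix (Fin N) (Fin N) ℂ)ˣ) (hV : ∀ i, i ≤ k' → ∀ x μ, V i x μ ∈ U1 (Matrix (Fin N) (Fin N) ℂ))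
    (hVp : ∀ i, i ≤ k' → ∀ (x : Site d) (μ ι : Fin d), V i (x + ((Nc i : ℕ) : ℤ) • e ι) μ = V i x μ)
    (a : ℕ → ℝ) (ha : ∀ i, 0 ≤ a i)
    (hplaq : ∀ i, i ≤ k' → ∀ (x : Site d) (μ ν : Fin d), μ ≠ ν → ‖((hol (V i) x (plaqWord μ ν) : (Matrix (Fin N) (Fin N) ℂ)ˣ) : Matrix (Fin N) (Fin N) ℂ) - 1‖ ≤ a i)
    (δ : ℕ → ℝ) (hδ : ∀ j, 0 ≤ δ j)
    (hbs : ∀ j, j < k' → ∀ (y : Site d) (ν : Fin d), ‖((V (j + 1) y ν : (Matrix (Fin N) (Fin N) ℂ)ˣ) : Matrix (Fin N) (Fin N) ℂ)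
      - ((hol (V j) ((L : ℤ) • y) (seg ν (L : ℤ)) : (Matrix (Fin N) (Fin N) ℂ)ˣ) : Matrix (Fin N) (Fin N) ℂ)‖ ≤ δ j)
    {w : ℝ}
    (hw : ∀ (z₀ : Fin d → Fin N') (κ : Fin d) (r : Fin d → Fin L),
      ‖((Wcx L (V k') ((L : ℤ) • boxVec N' z₀) κ (boxVec L r) : (Matrix (Fin N) (Fin N) ℂ)ˣ) : Matrix (Fin N) (Fin N) ℂ) - 1‖ ≤ w) (hw8 : w ≤ 1 / 8)
    (hbU : ∀ (z₀ : Fin d → Fin N') (κ : Fin d), bavg L (V k') ((L : ℤ) • boxVec N' z₀) κ ∈ U1 (Matrix (Fin N) (Fin N) ℂ))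
    (G : ℕ → Site d → Fin d → Matrix (Fin N) (Fin N) ℂ)
    (hGp : ∀ i, i ≤ k' → ∀ (x : Site d) (μ ι : Fin d), G i (x + ((Nc i : ℕ) : ℤ) • e ι) μ = G i x μ)
    (Λ : ℕ → Site d → Matrix (Fin N) (Fin N) ℂ) (hΛ0 : ∀ y, Λ 0 y = 0)
    (hΛs : ∀ i, i ≤ k' → ∀ y : Site d, Λ (i + 1) y = FhatCov L (V i) (G i) ((L : ℤ) • y) + Λ i ((L : ℤ) • y)) :
    ∑ z₀ : Fin d → Fin N', ∑ κ : Fin d,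
        ‖Λ (k' + 1) (boxVec N' z₀) - conjR (bavg L (V k') ((L : ℤ) • boxVec N' z₀) κ) (Λ (k' + 1) (boxVec N' z₀ + e κ))‖ ^ 2
      ≤ 3 * ((d : ℝ) * (((L : ℝ) ^ (k' + 1) - 1) / 2) ^ 2 * (((L : ℝ) ^ k')⁻¹ ^ 2 *
              (2 * ((L : ℝ) ^ d)⁻¹ * (L : ℝ) *
                  ((L : ℝ) * ∑ y : Fin d → Fin (Nc k'), ∑ μ : Fin d, ∑ ν : Fin d,
                    ‖conjR (V k' (boxVec (Nc k') y) ν) (G k' (boxVec (Nc k') y + e ν) μ) - G k' (boxVec (Nc k') y) μ‖ ^ 2)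
                + 2 * ((L : ℝ) ^ d)⁻¹ * (8 * (((d : ℝ) + 1) * (L : ℝ)) ^ 2 * a k' + 8 * w) ^ 2 *
                  ((d : ℝ) * ∑ y : Fin d → Fin (Nc k'), ∑ μ : Fin d, ‖G k' (boxVec (Nc k') y) μ‖ ^ 2)))
          + 2 * (d : ℝ) * (1 - (Real.sqrt L)⁻¹)⁻¹
              * ∑ j ∈ range k', (Real.sqrt L) ^ (k' - 1 - j) * (((L : ℝ) ^ (j + 1) - 1) / 2) ^ 2 *
                (((L : ℝ) ^ j)⁻¹ ^ 2 *
                  (((L : ℝ) ^ d)⁻¹ *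
                      (3 * N * ((n : ℝ) + 1) ^ 2 *
                          ((d : ℝ) * ((d : ℝ) * ((A : ℝ) ^ d * ∑ y : Fin d → Fin (Nc j), ∑ μ : Fin d, ∑ ν : Fin d,
                            ‖conjR (V j (boxVec (Nc j) y) ν) (G j (boxVec (Nc j) y + e ν) μ) - G j (boxVec (Nc j) y) μ‖ ^ 2)))
                        + (12 * N * ((n : ℝ) + 1) ^ 2 * (d : ℝ) ^ 3 * (n : ℝ) ^ 2 * a j ^ 2
                            + 3 * (2 * d * L * δ j + 2 * ((3 * d + 1) * n : ℝ) ^ 2 * a j) ^ 2) *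
                          ((d : ℝ) * ((d : ℝ) * ((A : ℝ) ^ d * ∑ y : Fin d → Fin (Nc j), ∑ μ : Fin d, ‖G j (boxVec (Nc j) y) μ‖ ^ 2))))
                    + 3 * ((L : ℝ) ^ 2)⁻¹ * ((L : ℝ) ^ d)⁻¹ *
                      ((d : ℝ) * ∑ μ : Fin d, ∑ y : Fin d → Fin (Nc (j + 1)),
                        ‖G (j + 1) (boxVec (Nc (j + 1)) y) μ
                          - ∑ r : Fin d → Fin L, ∑ t ∈ Finset.range L, (((L : ℝ) ^ d)⁻¹) •
                              conjR (hol (V j) ((L : ℤ) • boxVec (Nc (j + 1)) y) (treeWord (boxVec L r) ++ seg μ (t : ℤ)))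
                                (G j ((L : ℤ) • boxVec (Nc (j + 1)) y + boxVec L r + (t : ℤ) • e μ) μ)‖ ^ 2))
                + ((L : ℝ) ^ j)⁻¹ ^ 2 *
                  (((L : ℝ) ^ d)⁻¹ *
                      (3 * N * ((n : ℝ) + 1) ^ 2 *
                          ((d : ℝ) * ((d : ℝ) * ((A : ℝ) ^ d * ∑ y : Fin d → Fin (Nc j), ∑ μ : Fin d, ∑ ν : Fin d,
                            ‖conjR (V j (boxVec (Nc j) y) ν) (G j (boxVec (Nc j) y + e ν) μ) - G j (boxVec (Nc j) y) μ‖ ^ 2)))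
                        + (12 * N * ((n : ℝ) + 1) ^ 2 * (d : ℝ) ^ 3 * (n : ℝ) ^ 2 * a j ^ 2
                            + 3 * (2 * d * L * δ j + 2 * ((3 * d + 1) * n : ℝ) ^ 2 * a j) ^ 2) *
                          ((d : ℝ) * ((d : ℝ) * ((A : ℝ) ^ d * ∑ y : Fin d → Fin (Nc j), ∑ μ : Fin d, ‖G j (boxVec (Nc j) y) μ‖ ^ 2))))
                    + 3 * ((L : ℝ) ^ 2)⁻¹ * ((L : ℝ) ^ d)⁻¹ *
                      ((d : ℝ) * ∑ μ : Fin d, ∑ y : Fin d → Fin (Nc (j + 1)),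
                        ‖G (j + 1) (boxVec (Nc (j + 1)) y) μ
                          - ∑ r : Fin d → Fin L, ∑ t ∈ Finset.range L, (((L : ℝ) ^ d)⁻¹) •
                              conjR (hol (V j) ((L : ℤ) • boxVec (Nc (j + 1)) y) (treeWord (boxVec L r) ++ seg μ (t : ℤ)))
                                (G j ((L : ℤ) • boxVec (Nc (j + 1)) y + boxVec L r + (t : ℤ) • e μ) μ)‖ ^ 2)))
          + 2 * (1 - (Real.sqrt L)⁻¹)⁻¹ * ∑ i ∈ range (k' + 1), (Real.sqrt L) ^ (k' - i) *
              ((N / 2 * (d : ℝ) ^ 2 * ((L : ℝ) - 1) ^ 2 * (L : ℝ) ^ 2 *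
                  ((d : ℝ) * ∑ y : Fin d → Fin (Nc i), ∑ μ : Fin d, ∑ ν : Fin d,
                    ‖conjR (V i (boxVec (Nc i) y) ν) (G i (boxVec (Nc i) y + e ν) μ) - G i (boxVec (Nc i) y) μ‖ ^ 2)
                + (8 * (d : ℝ) ^ 6 * ((L : ℝ) - 1) ^ 6 + 2 * N * (d : ℝ) ^ 5 * ((L : ℝ) - 1) ^ 4 * (L : ℝ) ^ 2) * a i ^ 2 *
                  ((d : ℝ) * ∑ y : Fin d → Fin (Nc i), ∑ μ : Fin d, ‖G i (boxVec (Nc i) y) μ‖ ^ 2))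
              + (N / 2 * (d : ℝ) ^ 2 * ((L : ℝ) - 1) ^ 2 * (L : ℝ) ^ 2 *
                  ((d : ℝ) * ∑ y : Fin d → Fin (Nc i), ∑ μ : Fin d, ∑ ν : Fin d,
                    ‖conjR (V i (boxVec (Nc i) y) ν) (G i (boxVec (Nc i) y + e ν) μ) - G i (boxVec (Nc i) y) μ‖ ^ 2)
                + (8 * (d : ℝ) ^ 6 * ((L : ℝ) - 1) ^ 6 + 2 * N * (d : ℝ) ^ 5 * ((L : ℝ) - 1) ^ 4 * (L : ℝ) ^ 2) * a i ^ 2 *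
                  ((d : ℝ) * ∑ y : Fin d → Fin (Nc i), ∑ μ : Fin d, ‖G i (boxVec (Nc i) y) μ‖ ^ 2)))) := by
  -- the spliced tower: the top background repeated above the window; the gauge function by the full recursion
  obtain ⟨V', hVle, hV'⟩ : ∃ V' : ℕ → Site d → Fin d → (Matrix (Fin N) (Fin N) ℂ)ˣ,
      (∀ i, i ≤ k' → V' i = V i) ∧ (∀ i x μ, V' i x μ ∈ U1 (Matrix (Fin N) (Fin N) ℂ)) := by
    refine ⟨fun i => if i ≤ k' then V i else V k', fun i hi => if_pos hi, fun i x μ => ?_⟩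
    by_cases hi : i ≤ k'
    · simp only [if_pos hi]; exact hV i hi x μ
    · simp only [if_neg hi]; exact hV k' le_rfl x μ
  obtain ⟨Λ', hΛ'0, hΛ's⟩ : ∃ Λ' : ℕ → Site d → Matrix (Fin N) (Fin N) ℂ,
      (∀ y, Λ' 0 y = 0) ∧ (∀ (i : ℕ) (y : Site d), Λ' (i + 1) y = FhatCov L (V' i) (G i) ((L : ℤ) • y) + Λ' i ((L : ℤ) • y)) :=
    ⟨fun i => Nat.rec (motive := fun _ => Site d → Matrix (Fin N) (Fin N) ℂ) (Λ 0)
        (fun i Λi y => FhatCov L (V' i) (G i) ((L : ℤ) • y) + Λi ((L : ℤ) • y)) i, hΛ0, fun _ _ => rfl⟩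
  have hΛeq : ∀ i, i ≤ k' + 1 → ∀ y, Λ' i y = Λ i y := by
    intro i
    induction i with
    | zero => intro _ y; rw [hΛ'0, hΛ0]
    | succ i ih =>
      intro hi y
      rw [hΛ's, hΛs i (by omega), hVle i (by omega), ih (by omega)]
  have hΛfun : Λ' (k' + 1) = Λ (k' + 1) := funext (hΛeq (k' + 1) le_rfl)
  have hVk : V' k' = V k' := hVle k' le_rfl
  -- the hypotheses of ✓F-6d-3 transfer to the spliced tower
  have hVp' : ∀ i, i ≤ k' → ∀ (x : Site d) (μ ι : Fin d), V' i (x + ((Nc i : ℕ) : ℤ) • e ι) μ = V' i x μ := by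
    intro i hi; rw [hVle i hi]; exact hVp i hi
  have hplaq' : ∀ i, i ≤ k' → ∀ (x : Site d) (μ ν : Fin d), μ ≠ ν →
      ‖((hol (V' i) x (plaqWord μ ν) : (Matrix (Fin N) (Fin N) ℂ)ˣ) : Matrix (Fin N) (Fin N) ℂ) - 1‖ ≤ a i := by
    intro i hi; rw [hVle i hi]; exact hplaq i hi
  have hbs' : ∀ j, j < k' → ∀ (y : Site d) (ν : Fin d), ‖((V' (j + 1) y ν : (Matrix (Fin N) (Fin N) ℂ)ˣ) : Matrix (Fin N) (Fin N) ℂ)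
      - ((hol (V' j) ((L : ℤ) • y) (seg ν (L : ℤ)) : (Matrix (Fin N) (Fin N) ℂ)ˣ) : Matrix (Fin N) (Fin N) ℂ)‖ ≤ δ j := by
    intro j hj; rw [hVle (j + 1) (by omega), hVle j hj.le]; exact hbs j hj
  have hw' : ∀ (z₀ : Fin d → Fin N') (κ : Fin d) (r : Fin d → Fin L),
      ‖((Wcx L (V' k') ((L : ℤ) • boxVec N' z₀) κ (boxVec L r) : (Matrix (Fin N) (Fin N) ℂ)ˣ) : Matrix (Fin N) (Fin N) ℂ) - 1‖ ≤ w := by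
    rw [hVk]; exact hw
  have hbU' : ∀ (z₀ : Fin d → Fin N') (κ : Fin d), bavg L (V' k') ((L : ℤ) • boxVec N' z₀) κ ∈ U1 (Matrix (Fin N) (Fin N) ℂ) := by
    rw [hVk]; exact hbU
  have h := sum_cell_normSq_covGrad_gauge_le L hL n A hn hnA k' N' Nc hNc V' hV' hVp' a ha hplaq' δ hδ hbs' hw' hw8 hbU' G hGp Λ' hΛ'0 hΛ's
  rw [hΛfun, hVk] at h
  refine h.trans (le_of_eq ?_)
  have hVj : ∀ j ∈ range k', V' j = V j := fun j hj => hVle j (mem_range.1 hj).le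
  have hVi : ∀ i ∈ range (k' + 1), V' i = V i := fun i hi => hVle i (Nat.lt_succ_iff.1 (mem_range.1 hi))
  -- the right side is `3 * ((TOP + MID) + OSC)`; TOP already agrees, MID ∕ OSC differ by `V′ ↦ V` inside the level sums
  refine congrArg (fun t : ℝ => (3 : ℝ) * t) (congrArg₂ ((· + ·) : ℝ → ℝ → ℝ)
    (congrArg₂ ((· + ·) : ℝ → ℝ → ℝ) rfl (congrArg₂ ((· * ·) : ℝ → ℝ → ℝ) rfl ?_)) (congrArg₂ ((· * ·) : ℝ → ℝ → ℝ) rfl ?_))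
  · exact sum_congr rfl fun j hj => by rw [hVj j hj]
  · exact sum_congr rfl fun i hi => by rw [hVi i hi]

end Summit.QuantumFields.YangMills.Theorems.Prop7CornerCombCellKnitOfLe

end
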